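import Summits.HodgeConjecture.CorCM.IrreducibleOddWeightsMultiClassRank
import Summits.HodgeConjecture.CorCM.IrreducibleOddWeightsCommutantFamilyRank
import HarnessLib

/-!
# The multiplicity formula across all isotypic classes, VII: A DOMINATING SUB-FAMILY WITH FEW MEMBERS —
# `rank Σ = rank Σ|_U` with `|U| ≤ Σ_c n_c` and `Σ_c n_c·dim A_c ≤ dim Hg(∏_i A_i)`

COR-CM (cell `pub-hodgecm2`, binder seat `b16` gen 75, count-neutral claim THE MULTIPLICITY FORMULA ACROSS ALL
ISOTYPIC CLASSES FOR A WHOLE FAMILY, file M7 — type ranks; theorems only, no definition, no named fact, no `sorry`).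
NEW as stated, hence under `Summits/`.  HONEST FRAMING: finite-dimensional linear algebra about the Kubota–Dodson
rank of a family of CM types (`rank Σ − 1 = dim Hg(∏_i A_i)`); nothing about Hodge classes is asserted, `HC_CM` is
neither used nor asserted.  Gen 74 S5 (`…CommutantFamilyRank`): every product is Hodge-dominated by a sub-product of
at most `dim Hg(∏_i A_i)` factors, and inside ONE isotypic class of at most `dim Hg(∏_i A_i)/dim A` factors.  This
file runs S5's greedy exchange CLASS BY CLASS (files M1–M5): class `c` needs at most `r_c = dim B_c/dim A_c` members
(`B_c = ⨆_i S(p^i_c)` the class block, `Σ_c dim B_c = dim Hg(∏_i A_i)`), and the union over the classes dominates.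

* `exists_finset_typeRank_sigmaType_eq_card_le_sum_of_classes`: **there are a non-empty `U ⊆ I` and `n_c` with
  `rank Σ = rank Σ|_U`, `|U| ≤ Σ_c n_c` and `Σ_c n_c·dim A_c + 1 ≤ rank Σ`** — `∏_I A_i` is Hodge-dominated by a
  sub-product of at most `Σ_c n_c` factors, where the classes of large dimension `dim A_c` are charged accordingly;
  CM dress `exists_finset_cmFamilyRank_eq_card_le_sum_of_classes`.

## References

* [Deligne1982HodgeCycles] P. Deligne, *Hodge cycles on abelian varieties*, LNM 900 (1982), I.5 (p. 53), I Ex. 3.7.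
* [Gordon1999HodgeAVSurvey] B. B. Gordon, *A survey of the Hodge conjecture for abelian varieties*, §3 Theorem (proof),
  7.5–7.7.
* [Lang2002] S. Lang, *Algebra*, 3rd ed., XVII §1 (exchange over a division ring), XVII §3.
* [Mai1989] L. Mai, *Lower bounds for the ranks of CM types*, J. Number Theory 32 (1989), §2 Prop. 1.
-/

set_option autoImplicit false

noncomputable section

open scoped BigOperators Classical

universe u uC uJ v vC w

namespace Summit.HodgeConjecture.CorCM.IrrOdd

open Literature.NumberTheory.ComplexMultiplication

variable {G : Type w} [Group G]
  {I : Type u} {E : I → Type v} [∀ i, MulAction G (E i)] [∀ i, Fintype (E i)] [Fintype I] [∀ i, Nonempty (E i)]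
  {C : Type uC} [Fintype C] {Yc : C → Type vC} [∀ c, MulAction G (Yc c)] [∀ c, Fintype (Yc c)]
  {Ar : ∀ c, Submodule ℚ (Yc c → ℚ)} {𝒟 : ∀ c, Submodule ℚ ((Yc c → ℚ) →ₗ[ℚ] (Yc c → ℚ))}
  {JJ : I → C → Type uJ} [∀ i c, Fintype (JJ i c)]

/-- **A DOMINATING SUB-FAMILY WITH FEW MEMBERS, ACROSS ALL ISOTYPIC CLASSES.**  For a family of CM types whose type
vectors are decomposed over pairwise non-isomorphic references `A_c` (`A_c ≠ 0`, commutant ANY), there are a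
non-empty set of members `U` and numbers `n_c` with **`rank Σ = rank Σ|_U`, `|U| ≤ Σ_c n_c` and
`Σ_c n_c·dim A_c + 1 ≤ rank Σ`** — class by class, a greedy sub-family of `n_c ≤ dim B_c/dim A_c` members already
spans the class block `B_c = ⨆_i S(p^i_c)` (every `⨆_T S(p^i_c)` has dimension a multiple of `dim A_c`, file S3),
and `Σ_c dim B_c = dim Hg(∏_i A_i)` (file M2). [cite: Deligne1982HodgeCycles, I.5 (p. 53)]
[cite: Lang2002, XVII §1 and §3] [cite: Mai1989, §2 Prop. 1 (proof)] -/
theorem exists_finset_typeRank_sigmaType_eq_card_le_sum_of_classes [Nonempty I] {ρ : G} {Φ : ∀ i, Set (E i)}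
    (h : ∀ i, IsCMTypeWith ρ (Φ i))
    (h𝒟 : ∀ c (L : (Yc c → ℚ) →ₗ[ℚ] (Yc c → ℚ)), L ∈ 𝒟 c ↔ (∀ a ∈ Ar c, L a ∈ Ar c) ∧
      ∀ (k : G) (a : Yc c → ℚ), a ∈ Ar c → L (fun y => a (k • y)) = fun y => L a (k • y))
    (hRst : ∀ c (k : G) (a : Yc c → ℚ), a ∈ Ar c → (fun y => a (k • y)) ∈ Ar c)
    (hRirr : ∀ c (W : Submodule ℚ (Yc c → ℚ)), W ≤ Ar c → W ≠ ⊥ →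
      (∀ (k : G) (f : Yc c → ℚ), f ∈ W → (fun y => f (k • y)) ∈ W) → W = Ar c)
    (hR0 : ∀ c, Ar c ≠ ⊥)
    (hsep : ∀ c c' (L : (Yc c → ℚ) →ₗ[ℚ] (Yc c' → ℚ)), c ≠ c' → Ar c ≠ ⊥ → (∀ a ∈ Ar c, L a ∈ Ar c') →
      (∀ a ∈ Ar c, L a = 0 → a = 0) →
      (∀ (k : G) (a : Yc c → ℚ), a ∈ Ar c → L (fun y => a (k • y)) = fun y => L a (k • y)) → False)
    (ι : ∀ i c, JJ i c → ((Yc c → ℚ) →ₗ[ℚ] (E i → ℚ)))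
    (hιeq : ∀ i c (j : JJ i c) (k : G) (a : Yc c → ℚ), a ∈ Ar c →
      ι i c j (fun y => a (k • y)) = fun y => ι i c j a (k • y))
    (hind : ∀ i c (f : JJ i c → (Yc c → ℚ)), (∀ j, f j ∈ Ar c) → ∑ j, ι i c j (f j) = 0 → ∀ j, f j = 0)
    {b : ∀ i c, JJ i c → (Yc c → ℚ)} (hb : ∀ i c j, b i c j ∈ Ar c)
    (hu : ∀ i, antiVec (Φ i) (1 : G) = ∑ c, ∑ j, ι i c j (b i c j)) :
    ∃ U : Finset I, U.Nonempty ∧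
      typeRank G (sigmaType Φ) = typeRank G (sigmaType fun j : {i // i ∈ U} => Φ j.1) ∧
      ∃ n : C → ℕ, U.card ≤ ∑ c, n c ∧ (∑ c, n c * Module.finrank ℚ (Ar c)) + 1 ≤ typeRank G (sigmaType Φ) := by
  obtain ⟨i₀⟩ := ‹Nonempty I›
  haveI : Nonempty (Σ i, E i) := ⟨⟨i₀, Classical.arbitrary (E i₀)⟩⟩
  -- the class blocks, member by member
  set B : C → I → Submodule ℚ (G → ℚ) := fun c i =>
    Submodule.span ℚ (Set.range fun x : E i => fun g : G => (∑ j, ι i c j (b i c j)) (g • x)) with hB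
  haveI : ∀ c i, Module.Finite ℚ ↥(B c i) := fun c i => Module.Finite.span_of_finite ℚ (Set.finite_range _)
  haveI : ∀ c, Module.Finite ℚ ↥(⨆ i, B c i) := fun c => Submodule.finite_iSup _
  -- `dim A_c ∣ dim ⨆_{i∈T} B^i_c` for every `T` (file S3 on the members indexed by `T`)
  have hm : ∀ c (T : Finset I), Module.finrank ℚ (Ar c) ∣
      Module.finrank ℚ ↥(⨆ j : {i // i ∈ T}, B c j.1) := by
    intro c T
    obtain ⟨a₀, ha₀, h0⟩ := Submodule.exists_mem_ne_zero_of_ne_bot (hR0 c)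
    obtain ⟨r, -, -, hS⟩ := exists_rank_finrank_iSup_span_shadowCoeff_eq (Yf := fun j : {i // i ∈ T} => E j.1)
      (h𝒟 c) (hRst c) (hRirr c) (fun j => ι j.1 c) (fun j => hιeq j.1 c) (fun j => hind j.1 c) (fun j => hb j.1 c)
      ha₀ h0
    exact ⟨r, by rw [hS, mul_comm]⟩
  choose T hTeq hTcard using fun c => exists_finset_iSup_subtype_eq_card_mul_le (B c) (Module.finrank ℚ (Ar c))
    (hm c)
  -- the union of the class-wise greedy sub-families is non-empty: `MC_{i₀} ≠ 0` lies in its span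
  have hUne : (Finset.univ.biUnion T).Nonempty := by
    by_contra hU
    rw [Finset.not_nonempty_iff_eq_empty] at hU
    apply span_coeff_ne_bot (G := G) Φ i₀
    rw [span_coeff_eq_span_shadowCoeff_of_eq Φ i₀ (hu i₀),
      span_shadowCoeff_sum_classes_eq_iSup hRst hRirr hsep (ι i₀) (hιeq i₀) (hind i₀) (hb i₀), eq_bot_iff]
    refine iSup_le fun c => ?_
    have hTc : T c = ∅ :=
      Finset.subset_empty.1 (hU ▸ Finset.subset_biUnion_of_mem T (Finset.mem_univ c))
    have hle : B c i₀ ≤ ⨆ j : {i // i ∈ T c}, B c j.1 := by rw [hTeq c]; exact le_iSup (B c) i₀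
    rw [hTc, iSup_subtype_finset_empty] at hle
    exact hle
  obtain ⟨j₁, hj₁⟩ := hUne
  haveI : Nonempty (Σ j : {i // i ∈ Finset.univ.biUnion T}, E j.1) := ⟨⟨⟨j₁, hj₁⟩, Classical.arbitrary (E j₁)⟩⟩
  refine ⟨Finset.univ.biUnion T, ⟨j₁, hj₁⟩, ?_, ⟨fun c => (T c).card, Finset.card_biUnion_le, ?_⟩⟩
  · -- domination: every `MC_i = ⨆_c S(p^i_c)` lies in `⨆_{j ∈ U} MC_j`
    refine (typeRank_sigmaType_eq_reindex_iff_forall_span_coeff_le h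
      (Subtype.val : {i // i ∈ Finset.univ.biUnion T} → I)).2 fun i => ?_
    rw [span_coeff_eq_span_shadowCoeff_of_eq Φ i (hu i),
      span_shadowCoeff_sum_classes_eq_iSup hRst hRirr hsep (ι i) (hιeq i) (hind i) (hb i)]
    refine iSup_le fun c => ?_
    have hle : B c i ≤ ⨆ j : {i // i ∈ T c}, B c j.1 := by rw [hTeq c]; exact le_iSup (B c) i
    refine hle.trans (iSup_le fun j => ?_)
    have hjU : j.1 ∈ Finset.univ.biUnion T := Finset.mem_biUnion.2 ⟨c, Finset.mem_univ c, j.2⟩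
    refine le_trans ?_ (le_iSup _ ⟨j.1, hjU⟩)
    rw [span_coeff_eq_span_shadowCoeff_of_eq Φ j.1 (hu j.1),
      span_shadowCoeff_sum_classes_eq_iSup hRst hRirr hsep (ι j.1) (hιeq j.1) (hind j.1) (hb j.1)]
    exact le_iSup (fun c => B c j.1) c
  · -- the bound: `Σ_c |T_c|·dim A_c ≤ Σ_c dim B_c = rank Σ − 1`
    rw [(IsCMTypeWith.sigmaType h).typeRank_eq_finrank_antiSpan_add_one,
      finrank_antiSpan_sigmaType_eq_finrank_iSup_span_coeff Φ,
      iSup_congr fun i => span_coeff_eq_span_shadowCoeff_of_eq Φ i (hu i),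
      finrank_iSup_span_shadowCoeff_eq_sum_of_classes (Yf := E) hRst hRirr hsep ι hιeq hind hb]
    exact Nat.add_le_add_right (Finset.sum_le_sum fun c _ => hTcard c) 1

end Summit.HodgeConjecture.CorCM.IrrOdd

/-! ### CM dress -/

namespace Summit.HodgeConjecture.CorCM

open CategoryTheory CategoryTheory.Limits NumberField Module IntermediateField
open Literature.NumberTheory.ComplexMultiplication
open Literature.AlgebraicGeometry.Motives (AbelianVariety CMType)
open Literature.AlgebraicGeometry.Motives.AbelianVariety
open Literature.AlgebraicGeometry.HodgeTheory
open Literature.AlgebraicGeometry.ComplexMultiplication (IsCMTypeRealisation)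
open Literature.AlgebraicGeometry.Pohlmann1968

variable {I : Type} [Fintype I] {K : I → Type} [∀ i, Field (K i)] [∀ i, NumberField (K i)] [∀ i, IsCMField (K i)]
  {C : Type} [Fintype C] {Yc : C → Type} [∀ c, MulAction (ℂ ≃+* ℂ) (Yc c)] [∀ c, Fintype (Yc c)]
  {Ar : ∀ c, Submodule ℚ (Yc c → ℚ)} {𝒟 : ∀ c, Submodule ℚ ((Yc c → ℚ) →ₗ[ℚ] (Yc c → ℚ))}
  {JJ : I → C → Type} [∀ i c, Fintype (JJ i c)]

/-- **`∏_i A_i` IS HODGE-DOMINATED BY A SUB-PRODUCT OF AT MOST `Σ_c n_c` FACTORS, `Σ_c n_c·dim A_c ≤ dim Hg(∏_i A_i)`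
(CM fields)**: a non-empty `U` with `cmFamilyRank Φ = cmFamilyRank Φ|_U`, `|U| ≤ Σ_c n_c` and
`Σ_c n_c·dim A_c + 1 ≤ cmFamilyRank Φ`. [cite: Deligne1982HodgeCycles, I.5 (p. 53)] [cite: Lang2002, XVII §1 and §3]
[cite: Mai1989, §2 Prop. 1 (proof)] -/
theorem exists_finset_cmFamilyRank_eq_card_le_sum_of_classes [Nonempty I] (Φ : ∀ i, CMType (K i))
    (h𝒟 : ∀ c (L : (Yc c → ℚ) →ₗ[ℚ] (Yc c → ℚ)), L ∈ 𝒟 c ↔ (∀ a ∈ Ar c, L a ∈ Ar c) ∧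
      ∀ (k : ℂ ≃+* ℂ) (a : Yc c → ℚ), a ∈ Ar c → L (fun y => a (k • y)) = fun y => L a (k • y))
    (hRst : ∀ c (k : ℂ ≃+* ℂ) (a : Yc c → ℚ), a ∈ Ar c → (fun y => a (k • y)) ∈ Ar c)
    (hRirr : ∀ c (W : Submodule ℚ (Yc c → ℚ)), W ≤ Ar c → W ≠ ⊥ →
      (∀ (k : ℂ ≃+* ℂ) (f : Yc c → ℚ), f ∈ W → (fun y => f (k • y)) ∈ W) → W = Ar c)
    (hR0 : ∀ c, Ar c ≠ ⊥)
    (hsep : ∀ c c' (L : (Yc c → ℚ) →ₗ[ℚ] (Yc c' → ℚ)), c ≠ c' → Ar c ≠ ⊥ → (∀ a ∈ Ar c, L a ∈ Ar c') →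
      (∀ a ∈ Ar c, L a = 0 → a = 0) →
      (∀ (k : ℂ ≃+* ℂ) (a : Yc c → ℚ), a ∈ Ar c → L (fun y => a (k • y)) = fun y => L a (k • y)) → False)
    (ι : ∀ i c, JJ i c → ((Yc c → ℚ) →ₗ[ℚ] ((K i →+* ℂ) → ℚ)))
    (hιeq : ∀ i c (j : JJ i c) (k : ℂ ≃+* ℂ) (a : Yc c → ℚ), a ∈ Ar c →
      ι i c j (fun y => a (k • y)) = fun y => ι i c j a (k • y))
    (hind : ∀ i c (f : JJ i c → (Yc c → ℚ)), (∀ j, f j ∈ Ar c) → ∑ j, ι i c j (f j) = 0 → ∀ j, f j = 0)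
    {b : ∀ i c, JJ i c → (Yc c → ℚ)} (hb : ∀ i c j, b i c j ∈ Ar c)
    (hu : ∀ i, antiVec (Φ i).1 (1 : ℂ ≃+* ℂ) = ∑ c, ∑ j, ι i c j (b i c j)) :
    ∃ U : Finset I, U.Nonempty ∧ CMAlgebra.cmFamilyRank Φ = CMAlgebra.cmFamilyRank (fun j : U => Φ j.1) ∧
      ∃ n : C → ℕ, U.card ≤ ∑ c, n c ∧ (∑ c, n c * Module.finrank ℚ (Ar c)) + 1 ≤ CMAlgebra.cmFamilyRank Φ := by
  haveI : ∀ i, Nonempty (K i →+* ℂ) := fun i => inferInstance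
  exact IrrOdd.exists_finset_typeRank_sigmaType_eq_card_le_sum_of_classes (G := ℂ ≃+* ℂ)
    (E := fun i => K i →+* ℂ) (Φ := fun i => (Φ i).1) (fun i => isCMTypeWith_conj (Φ i)) h𝒟 hRst hRirr hR0 hsep
    ι hιeq hind hb hu

end Summit.HodgeConjecture.CorCM

end
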